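import Summits.AtomisticToContinuum.HydrodynamicLimit.Theses.TwoClocks
import Summits.AtomisticToContinuum.HydrodynamicLimit.Theorems.CorrectorPressureDecay.Negative.FreeFlow
import Summits.AtomisticToContinuum.HydrodynamicLimit.Theorems.CorrectorPressureDecay.Negative.Frame
import Summits.AtomisticToContinuum.HydrodynamicLimit.Theorems.TwoClocksEquilibriumShearWindowLDOneParticle
import Summits.AtomisticToContinuum.HydrodynamicLimit.Theorems.TwoClocksEquilibriumShearWindowLD

/-!
# `EquilibriumFastWindowLD` — negative knowledge (a.0): collisions are load-bearing — the crux FAILS at `σ = 0`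

Support file for crux `stmt-AtomisticToContinuum-14440` (`TwoClocks.EquilibriumFastWindowLD`, the
"fixed-density wall"), written by the standing disprover (cdisprove seat). The item's own docstring
says "crux 2 is false for free flight (Λ_τ ≡ Λ_(0+)) and is claimed only for 0 < σ < σ₀"; here that
sentence is a theorem about the crux's own objects:

* `EquilibriumFastWindowLDAt σ` — the crux's statement at a FIXED reduced diameter `σ` (every token
  after `σ < σ₀` verbatim, the flow type being `HardSphereFlow 𝕋³ (hsDiameter σ N) (N+1)`); the crux is
  `∃ σ₀ > 0, ∀ σ ∈ (0, σ₀), EquilibriumFastWindowLDAt σ` up to the order of two universal quantifiers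
  (`at_of_equilibriumFastWindowLD`);
* `equilibriumFastWindowLD_false_at_zero : ¬ EquilibriumFastWindowLDAt 0` — at `σ = 0` the free gas
  `freeFlow₀` (free flight IS a `HardSphereFlow` of diameter `hsDiameter 0 N = 0`,
  `CorrectorPressureDecay/Negative/FreeFlow.lean`) keeps every velocity, so for the kinetic shear stress
  `F(x,v) = v⁰v¹` (continuous, quadratic growth, `M_{1,0,1}`-orthogonal to `1, v_j, |v|²` — the
  admissibility lemmas of `TwoClocksEquilibriumShearWindowLD.lean`) the window average is the initial
  value for EVERY window, and the window exponential moment is the static Gaussian one,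
  `((1 - β²)^{-1/2})^{N+1}` (`lintegral_exp_sum_vel_localGibbsMeasure` × `lintegral_exp_mul_shear_gaussMeasure`),
  which exceeds `exp(β²(N+1)/8)` at every `N` (`exp_div_eight_lt_rpow_neg_half`): the conclusion fails at
  `β = min β₀ ½`, `ε = β²/8`, whatever `τ, N₀`.

Reading for provers: every hypothesis of the crux other than `0 < σ` — invariance and explicit form of
`G_N`, continuity, quadratic growth and the three orthogonality clauses of `F`, the window scaling
`w = τ(N+1)^{-1/3}`, `∃ β₀`, `∃ N₀` — is satisfied verbatim by the free gas, where the statement is false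
with pressure exactly `-½ log(1 - β²) ≥ β²/2` per particle at every window. Any proof must use `σ > 0`
through an actual collision mechanism, quantitatively in `τσ²` (the number of collisions per particle
per window), since `Λ_τ` is continuous neither in `σ → 0` at fixed `τ` nor uniform in `τ`.
All `[folklore]`.
-/

noncomputable section

open MeasureTheory ProbabilityTheory Real Set
open scoped ENNReal

namespace Summit.AtomisticToContinuum.HydrodynamicLimit.Theorems.EquilibriumFastWindowLDNegative

open Literature.Analysis.FluidPDE Literature.MathematicalPhysics.KineticTheory
open Summit.AtomisticToContinuum.HydrodynamicLimit.Theorems.CorrectorPressureDecayNegative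
open Summit.AtomisticToContinuum.HydrodynamicLimit.Theorems.CorrectorPressureDecayNegative.FreeFlow
  (freeFlow₀ freeFlow_flow hsDiameter_zero)

/-- **The crux at a fixed reduced diameter `σ`.** `TwoClocks.EquilibriumFastWindowLD` with the prefix
`∃ σ₀ > 0, … ∀ σ, 0 < σ → σ < σ₀ →` removed and `σ` a parameter; every other token verbatim. A variant
statement used to localise the load-bearing hypothesis `0 < σ`; not a fact. -/
def EquilibriumFastWindowLDAt (σ : ℝ) : Prop :=
  ∀ (a₀ θ₀ : ℝ) (u₀ : V3), 0 < a₀ → 0 < θ₀ →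
    ∀ Φ : (N : ℕ) → HardSphereFlow (Torus.geometry (Fin 3)) (hsDiameter σ N) (N + 1),
    ∀ F : T3 × V3 → ℝ, Continuous F → (∃ C : ℝ, ∀ y, |F y| ≤ C * (1 + ‖y.2‖ ^ 2)) →
    (∀ x, ∫ v, F (x, v) * localMaxwellian 1 θ₀ u₀ v = 0) →
    (∀ x (j : Fin 3), ∫ v, F (x, v) * v j * localMaxwellian 1 θ₀ u₀ v = 0) →
    (∀ x, ∫ v, F (x, v) * ‖v‖ ^ 2 * localMaxwellian 1 θ₀ u₀ v = 0) →
    ∃ β₀ : ℝ, 0 < β₀ ∧ ∀ β : ℝ, |β| ≤ β₀ → ∀ ε : ℝ, 0 < ε → ∃ τ : ℝ, 0 < τ ∧ ∃ N₀ : ℕ,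
      ∀ N : ℕ, N₀ ≤ N →
        ∫⁻ z, ENNReal.ofReal (Real.exp (β * ∑ i : Fin (N + 1),
            (τ * ((N : ℝ) + 1) ^ (-(1 / 3 : ℝ)))⁻¹ *
              ∫ r in (0 : ℝ)..(τ * ((N : ℝ) + 1) ^ (-(1 / 3 : ℝ))), F (((Φ N).flow r z) i)))
          ∂(localGibbsLaw σ (fun _ => a₀) (fun _ => u₀) (fun _ => θ₀) N (Φ N)) ≤
        ENNReal.ofReal (Real.exp (ε * ((N : ℝ) + 1)))

/-- The crux gives its fixed-diameter form at every `σ ∈ (0, σ₀)` (reordering of two universal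
quantifiers; recorded so that `¬ EquilibriumFastWindowLDAt σ` for SOME small positive `σ` would refute
the crux, while `σ = 0` — refuted below — is exactly the excluded endpoint). [folklore] -/
theorem at_of_equilibriumFastWindowLD (h : Theses.TwoClocks.EquilibriumFastWindowLD) :
    ∃ σ₀ : ℝ, 0 < σ₀ ∧ ∀ σ : ℝ, 0 < σ → σ < σ₀ → EquilibriumFastWindowLDAt σ := by
  obtain ⟨σ₀, hσ₀, H⟩ := h
  exact ⟨σ₀, hσ₀, fun σ hσ hσ' a₀ θ₀ u₀ ha hθ => H a₀ θ₀ u₀ ha hθ σ hσ hσ'⟩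

/-- **Free flight freezes window averages of velocity observables**: under `freeFlow₀ N` (free flight,
diameter `0`) the window average over `(0, w]`, `w > 0`, of any `f(v_i)` is `f(v_i(0))`, for EVERY
datum `z` (no good-set restriction: the flow map is free flight everywhere). [folklore] -/
theorem windowAverage_freeFlow₀ (N : ℕ) (f : V3 → ℝ) (z : Config (N + 1) (Fin 3) T3)
    (i : Fin (N + 1)) {w : ℝ} (hw : 0 < w) :
    w⁻¹ * ∫ r in (0 : ℝ)..w, f ((freeFlow₀ N).flow r z i).2 = f (z i).2 := by
  have h : ∫ r in (0 : ℝ)..w, f ((freeFlow₀ N).flow r z i).2 = ∫ _ in (0 : ℝ)..w, f (z i).2 := by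
    refine intervalIntegral.integral_congr fun r _ => ?_
    show f ((freeFlow₀ N).flow r z i).2 = f (z i).2
    rw [freeFlow₀, freeFlow_flow, freeFlight_apply]
  rw [h, intervalIntegral.integral_const, sub_zero, smul_eq_mul, ← mul_assoc,
    inv_mul_cancel₀ hw.ne', one_mul]

/-- **Exact window exponential moment of the kinetic shear stress for the free gas**: at `σ = 0`,
`a₀ > 0`, `θ₀ = 1`, `u₀ = 0`, for `β² < 1`, every `N` and every window `w > 0`,
`∫ exp(β Σᵢ w⁻¹∫₀ʷ vᵢ⁰(r)vᵢ¹(r) dr) dG_N = ((1 - β²)^{-1/2})^{N+1}` under the flow `freeFlow₀ N`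
(velocities frozen; positions and velocities independent, velocities i.i.d. standard Gaussian under
the ideal-gas Gibbs law). [folklore] -/
theorem shearWindowMoment_freeFlow₀_eq {a₀ : ℝ} (ha : 0 < a₀) (N : ℕ) {β : ℝ} (hβ : β ^ 2 < 1)
    {w : ℝ} (hw : 0 < w) :
    ∫⁻ z, ENNReal.ofReal (Real.exp (β * ∑ i : Fin (N + 1),
        w⁻¹ * ∫ r in (0 : ℝ)..w, (((freeFlow₀ N).flow r z i).2 0 * ((freeFlow₀ N).flow r z i).2 1)))
        ∂(localGibbsLaw 0 (fun _ => a₀) (fun _ => 0) (fun _ => 1) N (freeFlow₀ N)) =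
      ENNReal.ofReal ((1 - β ^ 2) ^ (-(1 / 2 : ℝ))) ^ (N + 1) := by
  have hpt : ∀ z : Config (N + 1) (Fin 3) T3,
      β * ∑ i : Fin (N + 1), w⁻¹ * ∫ r in (0 : ℝ)..w,
          (((freeFlow₀ N).flow r z i).2 0 * ((freeFlow₀ N).flow r z i).2 1) =
        ∑ i : Fin (N + 1), (fun v : V3 => β * (v 0 * v 1)) (z i).2 := by
    intro z
    rw [Finset.mul_sum]
    refine Finset.sum_congr rfl fun i _ => ?_
    rw [windowAverage_freeFlow₀ N (fun v : V3 => v 0 * v 1) z i hw]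
  simp_rw [hpt]
  rw [localGibbsLaw_eq, lintegral_exp_sum_vel_localGibbsMeasure ha one_pos (0 : V3)
    (by norm_num : (0 : ℝ) ≤ 1 / 2) N (by fun_prop : Measurable fun v : V3 => β * (v 0 * v 1)),
    lintegral_exp_mul_shear_gaussMeasure one_pos (by simpa using hβ)]
  simp

/-- **(a.0) Collisions are load-bearing: the crux FAILS at reduced diameter `σ = 0`.** Witness:
`a₀ = θ₀ = 1`, `u₀ = 0`, the free gas `freeFlow₀` (an inhabitant of the crux's flow type at `σ = 0`),
the kinetic shear stress `F(x,v) = v⁰v¹` (admissible: continuous, `|v⁰v¹| ≤ 1 + |v|²`, orthogonal to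
`1, v_j, |v|²` under `M_{1,0,1}` by parity); for the `β₀` produced, `β := min β₀ ½`, `ε := β²/8`: at
whatever `τ, N₀` are offered, at `N = N₀` the window moment is `((1-β²)^{-1/2})^{N+1} > exp(β²(N+1)/8)`.
[folklore] -/
theorem equilibriumFastWindowLD_false_at_zero : ¬ EquilibriumFastWindowLDAt 0 := by
  intro h
  set F : T3 × V3 → ℝ := fun y => (fun _ : T3 => (1 : ℝ)) y.1 * (y.2 0 * y.2 1) with hFdef
  obtain ⟨β₀, hβ₀, hβ⟩ := h 1 1 0 one_pos one_pos freeFlow₀ F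
    (continuous_shearStress continuous_const) (exists_shear_growth_bound continuous_const)
    (fun x => integral_shear_mul_localMaxwellian 1 1)
    (fun x j => integral_shear_mul_vel_mul_localMaxwellian 1 1 j)
    (fun x => integral_shear_mul_norm_sq_mul_localMaxwellian 1 1)
  -- a tilt in range
  set β : ℝ := min β₀ (1 / 2) with hβdef
  have hβpos : 0 < β := lt_min hβ₀ (by norm_num)
  have hβle : |β| ≤ β₀ := by
    rw [abs_of_pos hβpos]
    exact min_le_left _ _
  have hβhalf : β ≤ 1 / 2 := min_le_right _ _
  have hβsq : β ^ 2 ≤ 1 / 4 := by nlinarith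
  have hβ1 : β ^ 2 < 1 := by linarith
  obtain ⟨τ, hτ, N₀, hN⟩ := hβ β hβle (β ^ 2 / 8) (by positivity)
  have h0 := hN N₀ le_rfl
  have hw : 0 < τ * ((N₀ : ℝ) + 1) ^ (-(1 / 3 : ℝ)) :=
    mul_pos hτ (Real.rpow_pos_of_pos (by positivity) _)
  have hval := shearWindowMoment_freeFlow₀_eq one_pos N₀ hβ1 hw
  simp only [hFdef, one_mul] at h0
  rw [hval, ← ENNReal.ofReal_pow (Real.rpow_nonneg (by linarith) _),
    ENNReal.ofReal_le_ofReal_iff (Real.exp_pos _).le,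
    show β ^ 2 / 8 * ((N₀ : ℝ) + 1) = ((N₀ : ℝ) + 1) * (β ^ 2 / 8) by ring] at h0
  have hnat : Real.exp (β ^ 2 / 8) ^ (N₀ + 1) < ((1 - β ^ 2) ^ (-(1 / 2 : ℝ))) ^ (N₀ + 1) :=
    pow_lt_pow_left₀ (exp_div_eight_lt_rpow_neg_half (by positivity) hβsq) (Real.exp_pos _).le
      (Nat.succ_ne_zero N₀)
  have hcast : Real.exp (((N₀ : ℝ) + 1) * (β ^ 2 / 8)) = Real.exp (β ^ 2 / 8) ^ (N₀ + 1) := by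
    rw [← Real.exp_nat_mul]; push_cast; ring_nf
  rw [hcast] at h0
  exact absurd h0 (not_le.2 hnat)

end Summit.AtomisticToContinuum.HydrodynamicLimit.Theorems.EquilibriumFastWindowLDNegative

end
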